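import Mathlib.GroupTheory.Subgroup.Saturated
import Mathlib.GroupTheory.Finiteness
import Mathlib.LinearAlgebra.StdBasis
import Mathlib.Algebra.BigOperators.Pi
import Mathlib.Tactic

/-!
# Route `RadicialJung`, crux `CleanModelsSuffice`, line `Sketch`: the Kummer chart monoid

Helper for the registered stub `stub_charts` of the skeleton of
`Summit.ResolutionOfSingularities.ResolutionOfSingularities.Theses.RadicialJung.CleanModelsSuffice`
(stmt-ResolutionOfSingularities-15883). At a toroidal point of the clean model the Kato chart on
the normalisation is indexed by the **Kummer monoid**
`P_a = {c ∈ ℤ^{m+1} | 0 ≤ c₀, 0 ≤ a_i c₀ + p c_i (i ≠ 0)}` of exponents of the monomials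
`y^{c₀} ∏_{i ≠ 0} t_i^{c_i}` (`y^p = ∏ t_i^{a_i}`, `a₀ = 1`). This file is the pure
combinatorics of `P_a`: it is an fs monoid in the normal form of `LogRegularScheme.lean` —
finitely generated (by the unit vectors and the vectors `(j, -⌊j a_i / p⌋)_i`, `j ≤ p`),
saturated, and spanning `ℤ^{m+1}` — together with the linear "weights"
`w_i(c) = a_i c₀ + p c_i [i ≠ 0]`, the exponents of `t_i` in the `p`-th power of the monomial of
`c`, which are nonnegative exactly on `P_a`.
-/

set_option linter.dupNamespace false -- mandated namespace of this single-conjunct summit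

namespace Summit.ResolutionOfSingularities.ResolutionOfSingularities.Theorems.RadicialJung.CleanModelsSuffice

open Finset

variable (p : ℕ) {m : ℕ} (a : Fin (m + 1) → ℕ)

/-- The **Kummer monoid** `P_a = {c ∈ ℤ^{m+1} | 0 ≤ c₀ ∧ ∀ i ≠ 0, 0 ≤ a_i c₀ + p c_i}`: the
exponent vectors `c` of the monomials `y^{c₀} ∏_{i≠0} t_i^{c_i}` (`y^p = ∏ t_i^{a_i}`, `a₀ = 1`)
which are integral over `A`. [folklore] -/
def kummerMonoid : AddSubmonoid (Fin (m + 1) → ℤ) where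
  carrier := {c | 0 ≤ c 0 ∧ ∀ i : Fin (m + 1), i ≠ 0 → 0 ≤ (a i : ℤ) * c 0 + (p : ℤ) * c i}
  zero_mem' := ⟨le_rfl, fun i _ => by simp⟩
  add_mem' := by
    rintro c c' ⟨hc0, hc⟩ ⟨hc0', hc'⟩
    refine ⟨by simpa using add_nonneg hc0 hc0', fun i hi => ?_⟩
    have h := add_nonneg (hc i hi) (hc' i hi)
    simp only [Pi.add_apply, mul_add]
    linarith

/-- Membership in the Kummer monoid (`Iff.rfl`). [folklore] -/
theorem mem_kummerMonoid_iff (c : Fin (m + 1) → ℤ) :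
    c ∈ kummerMonoid p a ↔ 0 ≤ c 0 ∧ ∀ i : Fin (m + 1), i ≠ 0 → 0 ≤ (a i : ℤ) * c 0 + (p : ℤ) * c i :=
  Iff.rfl

/-- The Kummer monoid is saturated in `ℤ^{m+1}` (it is cut out by linear inequalities).
[folklore] -/
theorem kummerMonoid_nsmulSaturated : (kummerMonoid p a).NSMulSaturated := by
  intro n c hc
  rcases Nat.eq_zero_or_pos n with hn | hn
  · exact Or.inl hn
  right
  obtain ⟨h0, h⟩ := hc
  have hn' : (0 : ℤ) < n := by exact_mod_cast hn
  simp only [Pi.smul_apply, nsmul_eq_mul] at h0 h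
  refine ⟨(mul_nonneg_iff_of_pos_left hn').1 h0, fun i hi => ?_⟩
  have h1 := h i hi
  have eq : (a i : ℤ) * ((n : ℤ) * c 0) + (p : ℤ) * ((n : ℤ) * c i) =
      (n : ℤ) * ((a i : ℤ) * c 0 + (p : ℤ) * c i) := by ring
  rw [eq] at h1
  exact (mul_nonneg_iff_of_pos_left hn').1 h1

/-- The unit vectors lie in the Kummer monoid. [folklore] -/
theorem single_mem_kummerMonoid (i : Fin (m + 1)) :
    (Pi.single i 1 : Fin (m + 1) → ℤ) ∈ kummerMonoid p a := by
  have h1 : ∀ k, (0 : ℤ) ≤ (Pi.single i (1 : ℤ) : Fin (m + 1) → ℤ) k := fun k => by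
    rw [Pi.single_apply]
    split_ifs <;> norm_num
  exact ⟨h1 0, fun j _ =>
    add_nonneg (mul_nonneg (by positivity) (h1 0)) (mul_nonneg (by positivity) (h1 j))⟩

/-- The Kummer monoid spans `ℤ^{m+1}` as a group (it contains the unit vectors). [folklore] -/
theorem span_kummerMonoid_eq_top :
    Submodule.span ℤ (kummerMonoid p a : Set (Fin (m + 1) → ℤ)) = ⊤ := by
  refine top_unique ?_
  rw [← (Pi.basisFun ℤ (Fin (m + 1))).span_eq]
  refine Submodule.span_mono ?_
  rintro _ ⟨i, rfl⟩
  rw [Pi.basisFun_apply]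
  exact single_mem_kummerMonoid p a i

/-- A vector with nonnegative entries is a sum of unit vectors. [folklore] -/
theorem mem_closure_single_of_nonneg {n : ℕ} (v : Fin n → ℤ) (hv : ∀ i, 0 ≤ v i) :
    v ∈ AddSubmonoid.closure (Set.range fun i : Fin n => (Pi.single i 1 : Fin n → ℤ)) := by
  have hv' : v = ∑ i, (v i).toNat • (Pi.single i (1 : ℤ) : Fin n → ℤ) := by
    ext k
    rw [Finset.sum_apply, Finset.sum_eq_single k]
    · simp [Int.toNat_of_nonneg (hv k)]
    · intro i _ hik
      simp [Ne.symm hik]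
    · intro hk
      exact absurd (Finset.mem_univ k) hk
  rw [hv']
  exact AddSubmonoid.sum_mem _ fun i _ =>
    AddSubmonoid.nsmul_mem _ (AddSubmonoid.subset_closure (Set.mem_range_self i)) _

/-- The generators `g_j = (j, -⌊j a_1/p⌋, …, -⌊j a_m/p⌋)` of the Kummer monoid (the exponents of
`z_j = y^j / ∏ t_i^{⌊j a_i/p⌋}` up to the `t_0`-coordinate). [folklore] -/
def kummerGen (j : ℕ) : Fin (m + 1) → ℤ :=
  fun i => if i = 0 then (j : ℤ) else -((j * a i / p : ℕ) : ℤ)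

/-- The generators lie in the Kummer monoid. [folklore] -/
theorem kummerGen_mem (j : ℕ) : kummerGen p a j ∈ kummerMonoid p a := by
  refine ⟨by simp [kummerGen], fun i hi => ?_⟩
  simp only [kummerGen, if_neg hi, if_true]
  have h : ((j * a i / p : ℕ) : ℤ) * p ≤ (j : ℤ) * (a i : ℤ) := by
    exact_mod_cast Nat.div_mul_le_self (j * a i) p
  linarith

/-- Every element of the Kummer monoid is a nonnegative combination of the unit vectors and the
generators `g_j` (`j ≤ p`): with `c₀ = qp + j`, `c = q·g_p + g_j + Σ_{i≠0} n_i e_i`,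
`n_i = c_i + ⌊a_i c₀/p⌋ ≥ 0`. [folklore] -/
theorem kummerMonoid_le_closure (hp : 0 < p) :
    kummerMonoid p a ≤ AddSubmonoid.closure
      (Set.range (fun i : Fin (m + 1) => (Pi.single i 1 : Fin (m + 1) → ℤ)) ∪
        Set.range (fun j : Fin (p + 1) => kummerGen p a j)) := by
  rintro c ⟨h0, h⟩
  have hp' : (0 : ℤ) < p := by exact_mod_cast hp
  -- `c₀ = p q + j`
  set c₀ : ℕ := (c 0).toNat with hc₀_def
  have hc₀ : (c₀ : ℤ) = c 0 := Int.toNat_of_nonneg h0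
  set q : ℕ := c₀ / p with hq_def
  set j : ℕ := c₀ % p with hj_def
  have hjp : j < p + 1 := (Nat.mod_lt _ hp).trans (Nat.lt_succ_self p)
  have hqj : p * q + j = c₀ := Nat.div_add_mod c₀ p
  -- the tail `Σ_{i≠0} n_i e_i`
  let tail : Fin (m + 1) → ℤ := fun i => if i = 0 then 0 else c i + (a i : ℤ) * c 0 / p
  have htail : ∀ i, 0 ≤ tail i := by
    intro i
    by_cases hi : i = 0
    · simp [tail, hi]
    · simp only [tail, if_neg hi]
      have h1 := h i hi
      have h2 : -c i ≤ (a i : ℤ) * c 0 / p := by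
        rw [Int.le_ediv_iff_mul_le hp']
        linarith
      linarith
  have hdiv : ∀ i, (a i : ℤ) * c 0 / p = (q : ℤ) * a i + ((j * a i / p : ℕ) : ℤ) := by
    intro i
    have h1 : (a i : ℤ) * c 0 = ((a i * c₀ : ℕ) : ℤ) := by push_cast; rw [hc₀]
    have h2 : a i * c₀ / p = q * a i + j * a i / p := by
      rw [← hqj, Nat.mul_add, ← Nat.mul_assoc, Nat.mul_comm (a i) p, Nat.mul_assoc,
        Nat.mul_add_div hp, Nat.mul_comm (a i) q, Nat.mul_comm (a i) j]
    rw [h1, ← Int.natCast_div, h2]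
    push_cast
    ring
  have hdecomp : c = q • kummerGen p a p + kummerGen p a j + tail := by
    ext i
    by_cases hi : i = 0
    · subst hi
      simp only [Pi.add_apply, Pi.smul_apply]
      simp only [kummerGen, if_true, tail, add_zero]
      rw [← hc₀, ← hqj]
      push_cast
      ring
    · simp only [Pi.add_apply, Pi.smul_apply]
      simp only [kummerGen, if_neg hi, tail, Nat.mul_div_cancel_left _ hp, hdiv i]
      ring
  rw [hdecomp]
  set G : Set (Fin (m + 1) → ℤ) := Set.range (fun i : Fin (m + 1) => (Pi.single i 1 : Fin (m + 1) → ℤ)) ∪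
    Set.range (fun j : Fin (p + 1) => kummerGen p a j) with hG
  have h1 : kummerGen p a p ∈ AddSubmonoid.closure G :=
    AddSubmonoid.subset_closure (Set.mem_union_right _ ⟨⟨p, Nat.lt_succ_self p⟩, rfl⟩)
  have h2 : kummerGen p a j ∈ AddSubmonoid.closure G :=
    AddSubmonoid.subset_closure (Set.mem_union_right _ ⟨⟨j, hjp⟩, rfl⟩)
  have h3 : tail ∈ AddSubmonoid.closure G :=
    AddSubmonoid.closure_mono Set.subset_union_left (mem_closure_single_of_nonneg tail htail)
  exact add_mem (add_mem (AddSubmonoid.nsmul_mem _ h1 q) h2) h3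

/-- **The Kummer monoid is finitely generated** (by the unit vectors and the `g_j`, `j ≤ p`).
[folklore] -/
theorem kummerMonoid_fg (hp : 0 < p) : (kummerMonoid p a).FG := by
  classical
  refine ⟨(Finset.univ.image fun i : Fin (m + 1) => (Pi.single i (1 : ℤ) : Fin (m + 1) → ℤ)) ∪
    (Finset.univ.image fun j : Fin (p + 1) => kummerGen p a j), le_antisymm ?_ ?_⟩
  · rw [AddSubmonoid.closure_le]
    intro x hx
    simp only [Finset.coe_union, Finset.coe_image, Finset.coe_univ, Set.image_univ,
      Set.mem_union, Set.mem_range] at hx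
    rcases hx with ⟨i, rfl⟩ | ⟨j, rfl⟩
    · exact single_mem_kummerMonoid p a i
    · exact kummerGen_mem p a j
  · refine (kummerMonoid_le_closure p a hp).trans (AddSubmonoid.closure_mono ?_)
    simp only [Finset.coe_union, Finset.coe_image, Finset.coe_univ, Set.image_univ]
    rfl

/-- **The Kummer monoid is an fs monoid in normal form**: finitely generated, saturated, and
spanning `ℤ^{m+1}`. [folklore] -/
theorem kummerMonoid_fs (p : ℕ) (hp : 0 < p) {m : ℕ} (a : Fin (m + 1) → ℕ) :
    (kummerMonoid p a).FG ∧ (kummerMonoid p a).NSMulSaturated ∧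
      Submodule.span ℤ (kummerMonoid p a : Set (Fin (m + 1) → ℤ)) = ⊤ :=
  ⟨kummerMonoid_fg p a hp, kummerMonoid_nsmulSaturated p a, span_kummerMonoid_eq_top p a⟩

/-! ## The weights `w_i(c) = a_i c₀ + p c_i [i ≠ 0]` -/

/-- The **weight** `w_i(c) = a_i c₀ + p · c_i · [i ≠ 0]`: the exponent of `t_i` in the `p`-th
power `∏ t_i^{w_i(c)}` of the chart monomial `y^{c₀} ∏_{i≠0} t_i^{c_i}`. [folklore] -/
def kummerWeight (c : Fin (m + 1) → ℤ) (i : Fin (m + 1)) : ℤ :=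
  (a i : ℤ) * c 0 + if i = 0 then 0 else (p : ℤ) * c i

/-- The weight at the distinguished index `0`. [folklore] -/
theorem kummerWeight_zero_index (c : Fin (m + 1) → ℤ) :
    kummerWeight p a c 0 = (a 0 : ℤ) * c 0 := by
  simp [kummerWeight]

/-- The weight at an index `i ≠ 0`. [folklore] -/
theorem kummerWeight_of_ne_zero (c : Fin (m + 1) → ℤ) {i : Fin (m + 1)} (hi : i ≠ 0) :
    kummerWeight p a c i = (a i : ℤ) * c 0 + (p : ℤ) * c i := by
  simp [kummerWeight, hi]

/-- The weights are additive. [folklore] -/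
theorem kummerWeight_add (c c' : Fin (m + 1) → ℤ) (i : Fin (m + 1)) :
    kummerWeight p a (c + c') i = kummerWeight p a c i + kummerWeight p a c' i := by
  simp only [kummerWeight, Pi.add_apply]
  split_ifs <;> ring

/-- The weights vanish at `0`. [folklore] -/
theorem kummerWeight_zero (i : Fin (m + 1)) : kummerWeight p a 0 i = 0 := by
  simp [kummerWeight]

/-- On the Kummer monoid all weights are nonnegative. [folklore] -/
theorem kummerWeight_nonneg {c : Fin (m + 1) → ℤ} (hc : c ∈ kummerMonoid p a) (i : Fin (m + 1)) :
    0 ≤ kummerWeight p a c i := by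
  obtain ⟨h0, h⟩ := hc
  by_cases hi : i = 0
  · rw [hi, kummerWeight_zero_index]
    exact mul_nonneg (by positivity) h0
  · rw [kummerWeight_of_ne_zero p a c hi]
    exact h i hi

/-- Conversely, nonnegative weights (and `0 ≤ c₀`) put `c` in the Kummer monoid. [folklore] -/
theorem mem_kummerMonoid_of_kummerWeight_nonneg {c : Fin (m + 1) → ℤ} (h0 : 0 ≤ c 0)
    (h : ∀ i, i ≠ 0 → 0 ≤ kummerWeight p a c i) : c ∈ kummerMonoid p a :=
  ⟨h0, fun i hi => by rw [← kummerWeight_of_ne_zero p a c hi]; exact h i hi⟩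

/-- With `a₀ = 1` the weight at `0` is `c₀`. [folklore] -/
theorem kummerWeight_zero_index_of_eq_one (ha0 : a 0 = 1) (c : Fin (m + 1) → ℤ) :
    kummerWeight p a c 0 = c 0 := by
  rw [kummerWeight_zero_index, ha0, Nat.cast_one, one_mul]

/-- The weights are congruent to `a_i c₀` modulo `p`. [folklore] -/
theorem kummerWeight_modEq (c : Fin (m + 1) → ℤ) (i : Fin (m + 1)) :
    kummerWeight p a c i ≡ (a i : ℤ) * c 0 [ZMOD p] := by
  by_cases hi : i = 0
  · rw [hi, kummerWeight_zero_index]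
  · rw [kummerWeight_of_ne_zero p a c hi, Int.ModEq, Int.add_mul_emod_self_left]

end Summit.ResolutionOfSingularities.ResolutionOfSingularities.Theorems.RadicialJung.CleanModelsSuffice
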